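/-
Copyright (c) 2026 the pub-hodgecm-mathlib formalisation cell (harness21).  Prover seat hodgecm-mathlib-LH4-p14 (g6), req620 Track A «(D-RAM) FOUR-FRAME» squad, helper lane
on h413 = stmt-HodgeConjecture-24833 (count-neutral).  STAGE-1b ARITHMETIC brick (V8) — the token hypothesis `hA` of ★ p859212 ∕ ★ p859064 (V2) is LINEAR in the token: derived
pieces (T₊ = ½(lev − lev′) on the derived road, heir LEAD T19-32) inherit it with the linear combination of the letters.  2026-09-04.
-/
import Summits.HodgeConjecture.HodgeConjecture.Theorems.F0P3cDyRamFourFrameLawDefsR2     -- ★ №1-R2: `OmegaSchedule` (★ #0a `IsElementDatum`)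
import Summits.HodgeConjecture.HodgeConjecture.Theorems.F0P3cDyRamFourFrameHSideDefsR    -- ★ №2c-R: the place vocabulary
import HarnessLib

/-!
# Crux `H413`, line LH4 «(D-RAM) FOUR-FRAME» — (V8) THE AFFINE TOKEN HYPOTHESIS IS LINEAR IN THE TOKEN: `hA(A₁; cA₁, cB₁) ∧ hA(A₂; cA₂, cB₂) ⇒ hA(c₁A₁ + c₂A₂; c₁cA₁ + c₂cA₂, c₁cB₁ + c₂cB₂)`

Cell `hodgecm-mathlib` (D-0151), FLOOR 0, crux item H413 = `stmt-HodgeConjecture-24833`, route `HCCMUnconditional`; squad F0∕P3c∕LH4.  THEOREMS ONLY (no `def`, no instance, no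
notation, no `sorry`, default heartbeats); ★ `Theorems` imports only; lane `--supports stmt-HodgeConjecture-24833 --as helper`; COUNT-NEUTRAL (pure algebra on the `hA` text).

WHY.  On the DERIVED road of record (heir LEAD T19-32: «NO new primary (L-T+) letter — the T₊ law instance = ½·((L-lev) at a = ℓ₀ − (L-lev) at a = ℓ₀+1, both at square level m_c)»)
the κ-law token of `f_{T+}` is a LINEAR COMBINATION of two template tokens, `A_T = ½(A₁ − A₂)`.  ★ p859406 (V7) discharges the row-(1) hypothesis `hA` of ★ p859212 for each
shifted-amplitude token `Aᵢ` at explicit letters `(cAᵢ, cBᵢ)`; this file shows `hA` is LINEAR: `affine_token_linear (c₁ c₂ : ℚ) (hA12 : A = c₁·A₁ + c₂·A₂ pointwise) (h₁ : hA(A₁; cA₁,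
cB₁; N₁)) (h₂ : hA(A₂; cA₂, cB₂; N₂)) : hA(A; c₁cA₁ + c₂cA₂, c₁cB₁ + c₂cB₂; max N₁ N₂)`.  So ROW (1) of `f_{T+}` for `hFamily` on the derived road is ★ at the letters
`½(coefAffine-letters of lev_{ℓ₀,m_c} − those of lev_{ℓ₀+1,m_c})` by ★ p859406 §2 ×2 + this + ★ p859212, modulo the two level LAWS and the covered-cell sign fact — no fit.
HONEST LABEL.  Count-neutral; pays no registered stub, touches no `Lines/` module, asserts no law; `HC_CM` is proved only modulo the 7 printed citations (2 remaining named inputs: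
hLiu418 = `stmt-HodgeConjecture-24832`, h413 = `stmt-HodgeConjecture-24833`) until rung 0 closes.

## References
* [Rogawski1990] J. D. Rogawski, *Automorphic Representations of Unitary Groups in Three Variables*, Ann. of Math. Stud. 123 (1990): §4.3 (4.3.1) p. 43; §4.9 Prop. 4.9.1 (b) p. 55.
* [LabesseLanglands1979] J.-P. Labesse, R. P. Langlands, *L-indistinguishability for SL(2)*, Canad. J. Math. 31 (1979), §2 (2.2).
-/

set_option autoImplicit false

noncomputable section

namespace Summit.HodgeConjecture.HodgeConjecture.Cruxes.H413.F0P3cDyRamAffineTokenLinear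

open NumberField IsDedekindDomain
open Literature.NumberTheory.Automorphic Literature.NumberTheory.Automorphic.UnitaryGroup Literature.NumberTheory.GaloisRepresentations
open Literature.NumberTheory.Automorphic.UnitaryThreeFourFrame
open Summit.HodgeConjecture.HodgeConjecture.Cruxes.H413.F0P3cDyRamFourFrameLawDefsR2
open scoped Matrix MatrixGroups Classical ValuativeRel WithZero

/-- **(V8) `affine_token_linear` — THE `hA` OF ★ p859212 IS LINEAR IN THE TOKEN.**  If `hA` holds for `(A₁; cA₁, cB₁)` above the floor `N₁` and for `(A₂; cA₂, cB₂)` above `N₂`,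
and `A = c₁·A₁ + c₂·A₂` pointwise (`c₁ c₂ : ℚ`), then `hA` holds for `(A; c₁cA₁ + c₂cA₂, c₁cB₁ + c₂cB₂)` above `max N₁ N₂` — `push_cast` + `linear_combination`.
Use: T₊ on the derived road, `c₁ = ½`, `c₂ = −½` over the two level tokens at square level `m_c` (★ p859406 §2 supplies `h₁`, `h₂`).
[cite: Rogawski1990, §4.3 (4.3.1) p. 43; §4.9 Prop. 4.9.1 (b) p. 55] [cite: LabesseLanglands1979, §2 (2.2)] -/
theorem affine_token_linear (shift : ℕ → ℕ → ℤ) (Ω : OmegaSchedule) (N₀ : ℕ → ℕ) (A A₁ A₂ : ℕ → ℕ → ℕ → ℕ → ℤ → ℚ)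
    (L : Type) [Field L] [NumberField L] [IsCMField L]
    {v : HeightOneSpectrum (𝓞 ↥(maximalRealSubfield L))} (w : UnitaryGroup.PlacesOver L v)
    (hw : IsCMField.complexConj L • w.1 = w.1) (ϖ : (w.1.adicCompletion L)) (d tE : ℕ)
    [Fintype (Valued.ResidueField (w.1.adicCompletion L))] (C cA₁ cB₁ cA₂ cB₂ : ℂ) (N₁ N₂ : ℕ) (c₁ c₂ : ℚ)
    (hA12 : ∀ (q k : ℕ) (B : ℤ), A q d tE k B = c₁ * A₁ q d tE k B + c₂ * A₂ q d tE k B)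
    (h₁ : ∀ (a b : (w.1.adicCompletion L)) (n₁ n₂ n₃ k : ℕ) (i : Fin 3) (B : ℤ),
        a * (galAdicCompletionMap (L := L) (IsCMField.complexConj L) hw) a = 1 → b * (galAdicCompletionMap (L := L) (IsCMField.complexConj L) hw) b = 1 →
        IsElementDatum (galAdicCompletionMap (L := L) (IsCMField.complexConj L) hw) ϖ (N₀ d) (a * a) (b * b) n₁ n₂ n₃ →
        2 * ((n₁ + n₂) / 2) = n₁ + n₂ → 2 * k + d = n₁ + n₂ + n₃ + 2 → 2 * B = ((![n₁, n₂, n₃] : Fin 3 → ℕ) i : ℤ) - d + 2 - 2 * shift d tE → i = 2 →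
        N₁ ≤ n₃ → (n₃ + d) % 2 = 0 →
        C * ((Fintype.card (Valued.ResidueField (w.1.adicCompletion L)) : ℂ) ^ ((n₁ + n₂) / 2))⁻¹ * (((Ω (w.1.adicCompletion L) (galAdicCompletionMap (L := L) (IsCMField.complexConj L) hw) ϖ d a b i : ℤ) : ℂ) * ((A₁ (Fintype.card (Valued.ResidueField (w.1.adicCompletion L))) d tE k B : ℚ) : ℂ)) =
          cA₁ * (((2 * ((Fintype.card (Valued.ResidueField (w.1.adicCompletion L)) : ℚ) ^ (((n₃ - d) / 2 : ℕ) + 1) - 1) / ((Fintype.card (Valued.ResidueField (w.1.adicCompletion L)) : ℚ) - 1) : ℚ)) : ℂ) + cB₁)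
    (h₂ : ∀ (a b : (w.1.adicCompletion L)) (n₁ n₂ n₃ k : ℕ) (i : Fin 3) (B : ℤ),
        a * (galAdicCompletionMap (L := L) (IsCMField.complexConj L) hw) a = 1 → b * (galAdicCompletionMap (L := L) (IsCMField.complexConj L) hw) b = 1 →
        IsElementDatum (galAdicCompletionMap (L := L) (IsCMField.complexConj L) hw) ϖ (N₀ d) (a * a) (b * b) n₁ n₂ n₃ →
        2 * ((n₁ + n₂) / 2) = n₁ + n₂ → 2 * k + d = n₁ + n₂ + n₃ + 2 → 2 * B = ((![n₁, n₂, n₃] : Fin 3 → ℕ) i : ℤ) - d + 2 - 2 * shift d tE → i = 2 →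
        N₂ ≤ n₃ → (n₃ + d) % 2 = 0 →
        C * ((Fintype.card (Valued.ResidueField (w.1.adicCompletion L)) : ℂ) ^ ((n₁ + n₂) / 2))⁻¹ * (((Ω (w.1.adicCompletion L) (galAdicCompletionMap (L := L) (IsCMField.complexConj L) hw) ϖ d a b i : ℤ) : ℂ) * ((A₂ (Fintype.card (Valued.ResidueField (w.1.adicCompletion L))) d tE k B : ℚ) : ℂ)) =
          cA₂ * (((2 * ((Fintype.card (Valued.ResidueField (w.1.adicCompletion L)) : ℚ) ^ (((n₃ - d) / 2 : ℕ) + 1) - 1) / ((Fintype.card (Valued.ResidueField (w.1.adicCompletion L)) : ℚ) - 1) : ℚ)) : ℂ) + cB₂) :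
    ∀ (a b : (w.1.adicCompletion L)) (n₁ n₂ n₃ k : ℕ) (i : Fin 3) (B : ℤ),
        a * (galAdicCompletionMap (L := L) (IsCMField.complexConj L) hw) a = 1 → b * (galAdicCompletionMap (L := L) (IsCMField.complexConj L) hw) b = 1 →
        IsElementDatum (galAdicCompletionMap (L := L) (IsCMField.complexConj L) hw) ϖ (N₀ d) (a * a) (b * b) n₁ n₂ n₃ →
        2 * ((n₁ + n₂) / 2) = n₁ + n₂ → 2 * k + d = n₁ + n₂ + n₃ + 2 → 2 * B = ((![n₁, n₂, n₃] : Fin 3 → ℕ) i : ℤ) - d + 2 - 2 * shift d tE → i = 2 →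
        max N₁ N₂ ≤ n₃ → (n₃ + d) % 2 = 0 →
        C * ((Fintype.card (Valued.ResidueField (w.1.adicCompletion L)) : ℂ) ^ ((n₁ + n₂) / 2))⁻¹ * (((Ω (w.1.adicCompletion L) (galAdicCompletionMap (L := L) (IsCMField.complexConj L) hw) ϖ d a b i : ℤ) : ℂ) * ((A (Fintype.card (Valued.ResidueField (w.1.adicCompletion L))) d tE k B : ℚ) : ℂ)) =
          ((c₁ : ℂ) * cA₁ + (c₂ : ℂ) * cA₂) * (((2 * ((Fintype.card (Valued.ResidueField (w.1.adicCompletion L)) : ℚ) ^ (((n₃ - d) / 2 : ℕ) + 1) - 1) / ((Fintype.card (Valued.ResidueField (w.1.adicCompletion L)) : ℚ) - 1) : ℚ)) : ℂ) + ((c₁ : ℂ) * cB₁ + (c₂ : ℂ) * cB₂) := by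
  intro a b n₁ n₂ n₃ k i B ha hb hE hev hk hB hi hN hpar
  have e₁ := h₁ a b n₁ n₂ n₃ k i B ha hb hE hev hk hB hi (le_trans (le_max_left _ _) hN) hpar
  have e₂ := h₂ a b n₁ n₂ n₃ k i B ha hb hE hev hk hB hi (le_trans (le_max_right _ _) hN) hpar
  rw [hA12]
  push_cast at e₁ e₂ ⊢
  linear_combination (c₁ : ℂ) * e₁ + (c₂ : ℂ) * e₂

end Summit.HodgeConjecture.HodgeConjecture.Cruxes.H413.F0P3cDyRamAffineTokenLinear

end
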